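import Summits.QuantumFields.YangMills.Theorems.UnitScaleTiltProp7CovariantLatticeCaccioppoli
import Literature.MathematicalPhysics.QuantumFieldTheory.Balaban1983to89.B4Eq19LatticeDirichletReplacement
import HarnessLib

/-!
# Route `UnitScaleTilt`, crux K1 «MinimiserStabilityRegPr» (stmt-QuantumFields-19200), EX row (5) `h3` (STOREY H), H2 pipeline (ii) — programme **H2-LOC**, brick **(C2b, part 1):
# THE THREE PAIRINGS OF THE COVARIANT DIRICHLET COMPARISON** — for a test function `w` vanishing off `Q_{r+1}(z)`, the pairings of `w` with the covariant divergence datum, with the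
# site source, and with the PERTURBATION `(L^κ − L_R^κ)u` of a `δ`-small unitary background, each bounded by `√energy × √volume` factors; the perturbation bond by bond through the
# identity `⟪∇w,∇u⟫ − ⟪∇_Rw,∇_Ru⟫ = −⟪∇_Rw, q⟫ − ⟪p, ∇_Ru⟫ + ⟪p, q⟫` (`p = (R−1)w₊`, `q = (R−1)u₊`) — so that ONLY energies of `u` appear, never a sup of `∇u`
# (★CHAIR WORD №60 (2), ★★OWNER RULING №52: «the `(R−1)∇_Vu` cross term priced in `L²`»).

Cell `ym3-torus` (HUMAN RULING D-0037; rung R3 = SU(2) YM₃ on T³ — NOT d = 4, NOT infinite volume, NOT a mass gap, NOT Clay).  Width seat `ym3-torus-px19` (gen 16);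
`--supports stmt-QuantumFields-19200 --as helper`; count-neutral; THEOREMS ONLY (0 `def`, 0 `sorry`, default heartbeats).  Inputs BY NAME: (C1) ✓p780868
`Prop7CovariantLatticeCaccioppoli.sum_inner_covLop` ∕ `sum_inner_covDvg`; lit ✓`B4Eq19LatticeDirichletReplacement.sum_sum_mul_le_sqrt_mul_sqrt`.

OPERATORS written out as in (C1): `D_Rμ u(y) = R(y,μ)u(y+e_μ) − u(y)`, `(L_R^κ u)(y) = Σ_μ(2u(y) − R(y,μ)u(y+e_μ) − R(y−e_μ,μ)⁻¹u(y−e_μ)) + κu(y)`,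
`(D*_R g)(y) = Σ_μ(R(y−e_μ,μ)⁻¹g(y−e_μ,μ) − g(y,μ))`; flat = `R ≡ 1`.

WHAT IS PROVED (ns `Summit.QuantumFields.YangMills.Theorems.Prop7CovariantComparisonPairings`; `W` real inner-product space; box `Q_{r+2}(z)` of volume `V = (2r+5)^d`).
* §1 `refl_symm_apply`, ★`sum_inner_flatLop` (flat summation by parts = (C1) at `R ≡ 1`), `flatLop_sub`, `inner_flat_sub_cov` (the bond identity), `sq_le_five`, `sqrt_sum_const_le`
  (`√(Σ_{Q}Σ_μ c²) = c√(dV)`).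
* §2 ★`pairing_datum_le` — `Σ_{Q_{r+2}}⟪w, D*_Rg⟫ ≤ √(Σ‖D_Rw‖²)·m√(dV)` (`‖g‖ ≤ m` on `Q_{r+2}`); ★`pairing_source_le` — `Σ_{Q_{r+2}}⟪w, src⟫ ≤ √(Σ_{Q_{r+2}}‖w‖²)·σ√V`.
* §3 ★★`pairing_perturbation_le` — `Σ_{Q_{r+2}}Σ_μ(⟪w₊−w, u₊−u⟫ − ⟪D_Rw, D_Ru⟫) ≤ √(Σ‖D_Rw‖²)·δM_u√(dV) + √(ΣΣ‖w₊‖²)·δ√(Σ‖D_Ru‖²) + √(ΣΣ‖w₊‖²)·δ²M_u√(dV)`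
  (`‖u‖ ≤ M_u` on `Q_{r+3}`, `‖R(y,μ)x − x‖ ≤ δ‖x‖` on `Q_{r+2}`).
HYP-SAT (★★OWNER RULING №42): sup rows on boxes + a vanishing condition; inhabited by `0`; conclusions explicit real inequalities.
HONEST SCOPE.  [folklore] ([Giaquinta1984] Ch. III §2); the comparison theorem itself is (C2b, part 2) `…CovariantDirichletComparison`; nothing of `hHlocV`, `hWsup`, H2, `h3`, norm_G, EX,
19200 or the rung is proved; the Yang–Mills mass gap is NOT proved.

References: T. Bałaban, CMP **99** (1985) 389–434 [Balaban1985BackgroundPropagators] ((3.3) p.391, (3.8) p.392, (3.23) p.394, (3.35) p.396, Thm 3.1 (3.43) p.398);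
M. Giaquinta, *Multiple integrals …* (1983) [Giaquinta1984] (Ch. III §2 Thm 2.2 pp.78–79).
-/

set_option autoImplicit false

noncomputable section

open scoped BigOperators InnerProductSpace
open Finset

namespace Summit.QuantumFields.YangMills.Theorems.Prop7CovariantComparisonPairings

open Literature.MathematicalPhysics.QuantumFieldTheory.Balaban1983to89
open B4Eq19LatticeOperators (Zd unitVec box mem_box box_mono add_unitVec_mem_box card_box)
open B4Eq19LatticeDirichletReplacement (sum_sum_mul_le_sqrt_mul_sqrt)
open Summit.QuantumFields.YangMills.Theorems.Prop7CovariantLatticeCaccioppoli (sum_inner_covLop sum_inner_covDvg)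

variable {d : ℕ} {W : Type*} [NormedAddCommGroup W] [InnerProductSpace ℝ W]

/-! ## §1 Flat summation by parts and bond algebra -/

/-- `(refl)⁻¹ x = x`. [folklore] [cite: Balaban1985BackgroundPropagators, (3.3) p.391] -/
theorem refl_symm_apply (x : W) : (LinearIsometryEquiv.refl ℝ W).symm x = x := rfl

/-- ★ **FLAT SUMMATION BY PARTS** for `φ` vanishing off `Q_{R−1}(z)`: `Σ_{Q_R}⟪φ, L^κ u⟫ = Σ_{Q_R}Σ_μ⟪φ₊ − φ, u₊ − u⟫ + κΣ_{Q_R}⟪φ, u⟫` ((C1) ✓`sum_inner_covLop` at `R ≡ 1`).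
[folklore] [cite: Giaquinta1984, Ch. III §2 (2.3) p.77] -/
theorem sum_inner_flatLop (κ : ℝ) (φ u : Zd d → W) (z : Zd d) (Rr : ℤ) (hφ : ∀ y ∉ box z (Rr - 1), φ y = 0) :
    ∑ y ∈ box z Rr, ⟪φ y, (∑ μ, ((2 : ℝ) • u y - u (y + unitVec μ) - u (y - unitVec μ))) + κ • u y⟫_ℝ
      = (∑ y ∈ box z Rr, ∑ μ, ⟪φ (y + unitVec μ) - φ y, u (y + unitVec μ) - u y⟫_ℝ) + κ * ∑ y ∈ box z Rr, ⟪φ y, u y⟫_ℝ := by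
  have h := sum_inner_covLop (fun _ _ => LinearIsometryEquiv.refl ℝ W) κ φ u z Rr hφ
  simp only [LinearIsometryEquiv.coe_refl, id_eq, refl_symm_apply] at h
  exact h

/-- Linearity of the flat operator: `L^κ(u − w) = L^κ u − L^κ w` pointwise. [folklore] [cite: Giaquinta1984, Ch. III §2 p.77] -/
theorem flatLop_sub (κ : ℝ) (u w : Zd d → W) (y : Zd d) :
    (∑ μ, ((2 : ℝ) • (u y - w y) - (u (y + unitVec μ) - w (y + unitVec μ)) - (u (y - unitVec μ) - w (y - unitVec μ)))) + κ • (u y - w y)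
      = ((∑ μ, ((2 : ℝ) • u y - u (y + unitVec μ) - u (y - unitVec μ))) + κ • u y)
        - ((∑ μ, ((2 : ℝ) • w y - w (y + unitVec μ) - w (y - unitVec μ))) + κ • w y) := by
  have h : ∀ μ : Fin d, (2 : ℝ) • (u y - w y) - (u (y + unitVec μ) - w (y + unitVec μ)) - (u (y - unitVec μ) - w (y - unitVec μ))
      = ((2 : ℝ) • u y - u (y + unitVec μ) - u (y - unitVec μ)) - ((2 : ℝ) • w y - w (y + unitVec μ) - w (y - unitVec μ)) := fun μ => by
    rw [smul_sub]; abel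
  rw [Finset.sum_congr rfl fun μ _ => h μ, Finset.sum_sub_distrib, smul_sub]
  abel

/-- The bond identity behind the perturbation estimate: with `p := Rw₁ − w₁`, `q := Ru₁ − u₁`,
`⟪w₁ − w₀, u₁ − u₀⟫ − ⟪Rw₁ − w₀, Ru₁ − u₀⟫ = −⟪Rw₁ − w₀, q⟫ − ⟪p, Ru₁ − u₀⟫ + ⟪p, q⟫`. [folklore] [cite: Balaban1985BackgroundPropagators, (3.23) p.394] -/
theorem inner_flat_sub_cov (R : W ≃ₗᵢ[ℝ] W) (w₀ w₁ u₀ u₁ : W) :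
    ⟪w₁ - w₀, u₁ - u₀⟫_ℝ - ⟪R w₁ - w₀, R u₁ - u₀⟫_ℝ
      = -⟪R w₁ - w₀, R u₁ - u₁⟫_ℝ - ⟪R w₁ - w₁, R u₁ - u₀⟫_ℝ + ⟪R w₁ - w₁, R u₁ - u₁⟫_ℝ := by
  have e1 : w₁ - w₀ = (R w₁ - w₀) - (R w₁ - w₁) := by abel
  have e2 : u₁ - u₀ = (R u₁ - u₀) - (R u₁ - u₁) := by abel
  rw [e1, e2]
  simp only [inner_sub_left, inner_sub_right]
  ring

/-- `(x₁ + x₂ + x₃ + x₄ + x₅)² ≤ 5(x₁² + x₂² + x₃² + x₄² + x₅²)`. [folklore] [cite: Giaquinta1984, Ch. III §2 p.79] -/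
theorem sq_le_five (x₁ x₂ x₃ x₄ x₅ : ℝ) : (x₁ + x₂ + x₃ + x₄ + x₅) ^ 2 ≤ 5 * (x₁ ^ 2 + x₂ ^ 2 + x₃ ^ 2 + x₄ ^ 2 + x₅ ^ 2) := by
  nlinarith [sq_nonneg (x₁ - x₂), sq_nonneg (x₁ - x₃), sq_nonneg (x₁ - x₄), sq_nonneg (x₁ - x₅), sq_nonneg (x₂ - x₃), sq_nonneg (x₂ - x₄), sq_nonneg (x₂ - x₅),
    sq_nonneg (x₃ - x₄), sq_nonneg (x₃ - x₅), sq_nonneg (x₄ - x₅)]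

/-- A constant double sum under a square root: `√(Σ_{Q_{r+2}(z)}Σ_μ c²) = c·√(d·(2r+5)^d)` for `c ≥ 0`, `r ≥ 0`. [folklore] [cite: Giaquinta1984, Ch. III §1 p.64] -/
theorem sqrt_sum_const_eq (z : Zd d) {r : ℤ} (hr : 0 ≤ r) {c : ℝ} (hc : 0 ≤ c) :
    Real.sqrt (∑ _y ∈ box z (r + 2), ∑ _μ : Fin d, c ^ 2) = c * Real.sqrt (d * ((2 * (r + 2) + 1 : ℤ) : ℝ) ^ d) := by
  have hV := card_box z (r := r + 2) (by linarith)
  simp only [Finset.sum_const, Finset.card_univ, Fintype.card_fin, nsmul_eq_mul]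
  rw [hV, show ((2 * (r + 2) + 1 : ℤ) : ℝ) ^ d * ((d : ℝ) * c ^ 2) = c ^ 2 * ((d : ℝ) * ((2 * (r + 2) + 1 : ℤ) : ℝ) ^ d) by ring,
    Real.sqrt_mul' _ (by positivity), Real.sqrt_sq hc]

/-! ## §2 ★ The datum and source pairings -/

/-- ★ **THE DATUM PAIRING**: for `w` vanishing off `Q_{r+1}(z)` and `‖g(y,μ)‖ ≤ m` on `Q_{r+2}(z)`,
`Σ_{Q_{r+2}}⟪w, D*_R g⟫ ≤ √(Σ_{Q_{r+2}}Σ_μ‖D_Rμ w‖²)·m·√(d(2r+5)^d)` ((C1) ✓`sum_inner_covDvg` + Cauchy–Schwarz).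
[folklore] [cite: Giaquinta1984, Ch. III §2 (2.8) p.79; Balaban1985BackgroundPropagators, (3.8) p.392] -/
theorem pairing_datum_le (R : Zd d → Fin d → (W ≃ₗᵢ[ℝ] W)) (w : Zd d → W) (g : Zd d → Fin d → W) (z : Zd d) {r : ℤ} (hr : 0 ≤ r)
    (hw0 : ∀ y ∉ box z (r + 1), w y = 0) {m : ℝ} (hm : 0 ≤ m) (hg : ∀ y ∈ box z (r + 2), ∀ μ, ‖g y μ‖ ≤ m) :
    ∑ y ∈ box z (r + 2), ⟪w y, ∑ μ, ((R (y - unitVec μ) μ).symm (g (y - unitVec μ) μ) - g y μ)⟫_ℝ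
      ≤ Real.sqrt (∑ y ∈ box z (r + 2), ∑ μ, ‖R y μ (w (y + unitVec μ)) - w y‖ ^ 2) * (m * Real.sqrt (d * ((2 * (r + 2) + 1 : ℤ) : ℝ) ^ d)) := by
  have hw0' : ∀ y ∉ box z (r + 2 - 1), w y = 0 := fun y hy => hw0 y (by rwa [show r + 2 - 1 = r + 1 by ring] at hy)
  rw [sum_inner_covDvg R w g z (r + 2) hw0']
  have h1 : ∑ y ∈ box z (r + 2), ∑ μ, ⟪R y μ (w (y + unitVec μ)) - w y, g y μ⟫_ℝ
      ≤ ∑ y ∈ box z (r + 2), ∑ μ, ‖R y μ (w (y + unitVec μ)) - w y‖ * ‖g y μ‖ :=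
    Finset.sum_le_sum fun y _ => Finset.sum_le_sum fun μ _ => real_inner_le_norm _ _
  have h2 := sum_sum_mul_le_sqrt_mul_sqrt (box z (r + 2)) (fun y μ => ‖R y μ (w (y + unitVec μ)) - w y‖) (fun y μ => ‖g y μ‖)
  have h3 : ∑ y ∈ box z (r + 2), ∑ μ, ‖g y μ‖ ^ 2 ≤ ∑ _y ∈ box z (r + 2), ∑ _μ : Fin d, m ^ 2 :=
    Finset.sum_le_sum fun y hy => Finset.sum_le_sum fun μ _ => pow_le_pow_left₀ (norm_nonneg _) (hg y hy μ) 2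
  have h5 : Real.sqrt (∑ y ∈ box z (r + 2), ∑ μ, ‖g y μ‖ ^ 2) ≤ m * Real.sqrt (d * ((2 * (r + 2) + 1 : ℤ) : ℝ) ^ d) := by
    rw [← sqrt_sum_const_eq z hr hm]; exact Real.sqrt_le_sqrt h3
  exact h1.trans (h2.trans (mul_le_mul_of_nonneg_left h5 (Real.sqrt_nonneg _)))

/-- ★ **THE SOURCE PAIRING**: for `‖src‖ ≤ σ` on `Q_{r+2}(z)`, `Σ_{Q_{r+2}}⟪w, src⟫ ≤ √(Σ_{Q_{r+2}}‖w‖²)·σ·√((2r+5)^d)`. [folklore] [cite: Giaquinta1984, Ch. III §2 p.79] -/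
theorem pairing_source_le (w src : Zd d → W) (z : Zd d) {r : ℤ} (hr : 0 ≤ r) {σ : ℝ} (hσ : 0 ≤ σ) (hs : ∀ y ∈ box z (r + 2), ‖src y‖ ≤ σ) :
    ∑ y ∈ box z (r + 2), ⟪w y, src y⟫_ℝ ≤ Real.sqrt (∑ y ∈ box z (r + 2), ‖w y‖ ^ 2) * (σ * Real.sqrt (((2 * (r + 2) + 1 : ℤ) : ℝ) ^ d)) := by
  have h1 : ∑ y ∈ box z (r + 2), ⟪w y, src y⟫_ℝ ≤ ∑ y ∈ box z (r + 2), ‖w y‖ * ‖src y‖ := Finset.sum_le_sum fun y _ => real_inner_le_norm _ _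
  have h2 := Real.sum_mul_le_sqrt_mul_sqrt (box z (r + 2)) (fun y => ‖w y‖) (fun y => ‖src y‖)
  have h3 : ∑ y ∈ box z (r + 2), ‖src y‖ ^ 2 ≤ ∑ _y ∈ box z (r + 2), σ ^ 2 := Finset.sum_le_sum fun y hy => pow_le_pow_left₀ (norm_nonneg _) (hs y hy) 2
  have hV := card_box z (r := r + 2) (by linarith)
  simp only [Finset.sum_const, nsmul_eq_mul] at h3
  rw [hV] at h3
  have h5 : Real.sqrt (∑ y ∈ box z (r + 2), ‖src y‖ ^ 2) ≤ σ * Real.sqrt (((2 * (r + 2) + 1 : ℤ) : ℝ) ^ d) := by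
    have e : σ * Real.sqrt (((2 * (r + 2) + 1 : ℤ) : ℝ) ^ d) = Real.sqrt (((2 * (r + 2) + 1 : ℤ) : ℝ) ^ d * σ ^ 2) := by
      rw [mul_comm (_ ^ d), Real.sqrt_mul' _ (pow_nonneg (by exact_mod_cast (by linarith : (0:ℤ) ≤ 2 * (r + 2) + 1)) _), Real.sqrt_sq hσ]
    rw [e]; exact Real.sqrt_le_sqrt h3
  exact h1.trans (h2.trans (mul_le_mul_of_nonneg_left h5 (Real.sqrt_nonneg _)))

/-! ## §3 ★★ The perturbation pairing -/

/-- ★★ **THE PERTURBATION PAIRING** (flat form minus covariant form on the bonds of `Q_{r+2}(z)`): if `‖u‖ ≤ M_u` on `Q_{r+3}(z)` and `‖R(y,μ)x − x‖ ≤ δ‖x‖` for `y ∈ Q_{r+2}(z)`,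
then `Σ_{Q_{r+2}}Σ_μ (⟪w₊ − w, u₊ − u⟫ − ⟪D_Rw, D_Ru⟫) ≤ √E_R·δM_u√(dV) + √W₊·δ√Φ + √W₊·δ²M_u√(dV)` with `E_R = ΣΣ‖D_Rw‖²`, `W₊ = ΣΣ‖w₊‖²`, `Φ = ΣΣ‖D_Ru‖²`,
`V = (2r+5)^d` — `inner_flat_sub_cov` bond by bond, Cauchy–Schwarz thrice; NO sup of `∇u`. [folklore] [cite: Giaquinta1984, Ch. III §2 Thm 2.2 p.79; Balaban1985BackgroundPropagators, (3.35) p.396] -/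
theorem pairing_perturbation_le (R : Zd d → Fin d → (W ≃ₗᵢ[ℝ] W)) (w u : Zd d → W) (z : Zd d) {r : ℤ} (hr : 0 ≤ r) {Mu δ : ℝ} (hMu : 0 ≤ Mu) (hδ : 0 ≤ δ)
    (hu : ∀ y ∈ box z (r + 3), ‖u y‖ ≤ Mu) (hR : ∀ y ∈ box z (r + 2), ∀ (μ : Fin d) (x : W), ‖R y μ x - x‖ ≤ δ * ‖x‖) :
    ∑ y ∈ box z (r + 2), ∑ μ, (⟪w (y + unitVec μ) - w y, u (y + unitVec μ) - u y⟫_ℝ - ⟪R y μ (w (y + unitVec μ)) - w y, R y μ (u (y + unitVec μ)) - u y⟫_ℝ)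
      ≤ Real.sqrt (∑ y ∈ box z (r + 2), ∑ μ, ‖R y μ (w (y + unitVec μ)) - w y‖ ^ 2) * (δ * Mu * Real.sqrt (d * ((2 * (r + 2) + 1 : ℤ) : ℝ) ^ d))
        + Real.sqrt (∑ y ∈ box z (r + 2), ∑ μ, ‖w (y + unitVec μ)‖ ^ 2) * (δ * Real.sqrt (∑ y ∈ box z (r + 2), ∑ μ, ‖R y μ (u (y + unitVec μ)) - u y‖ ^ 2))
        + Real.sqrt (∑ y ∈ box z (r + 2), ∑ μ, ‖w (y + unitVec μ)‖ ^ 2) * (δ ^ 2 * Mu * Real.sqrt (d * ((2 * (r + 2) + 1 : ℤ) : ℝ) ^ d)) := by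
  simp_rw [inner_flat_sub_cov]
  have hq : ∀ y ∈ box z (r + 2), ∀ μ, ‖R y μ (u (y + unitVec μ)) - u (y + unitVec μ)‖ ≤ δ * Mu := by
    intro y hy μ
    have hmem : y + unitVec μ ∈ box z (r + 3) := by have := add_unitVec_mem_box hy μ; rwa [show r + 2 + 1 = r + 3 by ring] at this
    exact (hR y hy μ _).trans (mul_le_mul_of_nonneg_left (hu _ hmem) hδ)
  have hp : ∀ y ∈ box z (r + 2), ∀ μ, ‖R y μ (w (y + unitVec μ)) - w (y + unitVec μ)‖ ≤ δ * ‖w (y + unitVec μ)‖ := fun y hy μ => hR y hy μ _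
  -- T1
  have T1 : ∑ y ∈ box z (r + 2), ∑ μ, -⟪R y μ (w (y + unitVec μ)) - w y, R y μ (u (y + unitVec μ)) - u (y + unitVec μ)⟫_ℝ
      ≤ Real.sqrt (∑ y ∈ box z (r + 2), ∑ μ, ‖R y μ (w (y + unitVec μ)) - w y‖ ^ 2) * (δ * Mu * Real.sqrt (d * ((2 * (r + 2) + 1 : ℤ) : ℝ) ^ d)) := by
    have h1 : ∑ y ∈ box z (r + 2), ∑ μ, -⟪R y μ (w (y + unitVec μ)) - w y, R y μ (u (y + unitVec μ)) - u (y + unitVec μ)⟫_ℝ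
        ≤ ∑ y ∈ box z (r + 2), ∑ μ, ‖R y μ (w (y + unitVec μ)) - w y‖ * (δ * Mu) :=
      Finset.sum_le_sum fun y hy => Finset.sum_le_sum fun μ _ => by
        have ha := abs_real_inner_le_norm (R y μ (w (y + unitVec μ)) - w y) (R y μ (u (y + unitVec μ)) - u (y + unitVec μ))
        have hb := neg_le_abs ⟪R y μ (w (y + unitVec μ)) - w y, R y μ (u (y + unitVec μ)) - u (y + unitVec μ)⟫_ℝ
        exact hb.trans (ha.trans (mul_le_mul_of_nonneg_left (hq y hy μ) (norm_nonneg _)))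
    have h2 := sum_sum_mul_le_sqrt_mul_sqrt (box z (r + 2)) (fun y μ => ‖R y μ (w (y + unitVec μ)) - w y‖) (fun _ _ => δ * Mu)
    rw [sqrt_sum_const_eq z hr (by positivity : 0 ≤ δ * Mu)] at h2
    exact h1.trans h2
  -- T2
  have T2 : ∑ y ∈ box z (r + 2), ∑ μ, -⟪R y μ (w (y + unitVec μ)) - w (y + unitVec μ), R y μ (u (y + unitVec μ)) - u y⟫_ℝ
      ≤ Real.sqrt (∑ y ∈ box z (r + 2), ∑ μ, ‖w (y + unitVec μ)‖ ^ 2) * (δ * Real.sqrt (∑ y ∈ box z (r + 2), ∑ μ, ‖R y μ (u (y + unitVec μ)) - u y‖ ^ 2)) := by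
    have h1 : ∑ y ∈ box z (r + 2), ∑ μ, -⟪R y μ (w (y + unitVec μ)) - w (y + unitVec μ), R y μ (u (y + unitVec μ)) - u y⟫_ℝ
        ≤ ∑ y ∈ box z (r + 2), ∑ μ, ‖w (y + unitVec μ)‖ * (δ * ‖R y μ (u (y + unitVec μ)) - u y‖) :=
      Finset.sum_le_sum fun y hy => Finset.sum_le_sum fun μ _ => by
        have ha := abs_real_inner_le_norm (R y μ (w (y + unitVec μ)) - w (y + unitVec μ)) (R y μ (u (y + unitVec μ)) - u y)
        have hb := neg_le_abs ⟪R y μ (w (y + unitVec μ)) - w (y + unitVec μ), R y μ (u (y + unitVec μ)) - u y⟫_ℝ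
        refine hb.trans (ha.trans ?_)
        calc ‖R y μ (w (y + unitVec μ)) - w (y + unitVec μ)‖ * ‖R y μ (u (y + unitVec μ)) - u y‖
            ≤ (δ * ‖w (y + unitVec μ)‖) * ‖R y μ (u (y + unitVec μ)) - u y‖ := mul_le_mul_of_nonneg_right (hp y hy μ) (norm_nonneg _)
          _ = ‖w (y + unitVec μ)‖ * (δ * ‖R y μ (u (y + unitVec μ)) - u y‖) := by ring
    have h2 := sum_sum_mul_le_sqrt_mul_sqrt (box z (r + 2)) (fun y μ => ‖w (y + unitVec μ)‖) (fun y μ => δ * ‖R y μ (u (y + unitVec μ)) - u y‖)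
    have h4 : Real.sqrt (∑ y ∈ box z (r + 2), ∑ μ, (δ * ‖R y μ (u (y + unitVec μ)) - u y‖) ^ 2)
        = δ * Real.sqrt (∑ y ∈ box z (r + 2), ∑ μ, ‖R y μ (u (y + unitVec μ)) - u y‖ ^ 2) := by
      have e : ∑ y ∈ box z (r + 2), ∑ μ, (δ * ‖R y μ (u (y + unitVec μ)) - u y‖) ^ 2 = δ ^ 2 * ∑ y ∈ box z (r + 2), ∑ μ, ‖R y μ (u (y + unitVec μ)) - u y‖ ^ 2 := by
        rw [Finset.mul_sum]
        refine Finset.sum_congr rfl fun y _ => ?_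
        rw [Finset.mul_sum]
        exact Finset.sum_congr rfl fun μ _ => by ring
      rw [e, Real.sqrt_mul' _ (Finset.sum_nonneg fun _ _ => Finset.sum_nonneg fun _ _ => sq_nonneg _), Real.sqrt_sq hδ]
    rw [h4] at h2
    exact h1.trans h2
  -- T3
  have T3 : ∑ y ∈ box z (r + 2), ∑ μ, ⟪R y μ (w (y + unitVec μ)) - w (y + unitVec μ), R y μ (u (y + unitVec μ)) - u (y + unitVec μ)⟫_ℝ
      ≤ Real.sqrt (∑ y ∈ box z (r + 2), ∑ μ, ‖w (y + unitVec μ)‖ ^ 2) * (δ ^ 2 * Mu * Real.sqrt (d * ((2 * (r + 2) + 1 : ℤ) : ℝ) ^ d)) := by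
    have h1 : ∑ y ∈ box z (r + 2), ∑ μ, ⟪R y μ (w (y + unitVec μ)) - w (y + unitVec μ), R y μ (u (y + unitVec μ)) - u (y + unitVec μ)⟫_ℝ
        ≤ ∑ y ∈ box z (r + 2), ∑ μ, ‖w (y + unitVec μ)‖ * (δ ^ 2 * Mu) :=
      Finset.sum_le_sum fun y hy => Finset.sum_le_sum fun μ _ => by
        refine (real_inner_le_norm _ _).trans ?_
        calc ‖R y μ (w (y + unitVec μ)) - w (y + unitVec μ)‖ * ‖R y μ (u (y + unitVec μ)) - u (y + unitVec μ)‖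
            ≤ (δ * ‖w (y + unitVec μ)‖) * (δ * Mu) := mul_le_mul (hp y hy μ) (hq y hy μ) (norm_nonneg _) (by positivity)
          _ = ‖w (y + unitVec μ)‖ * (δ ^ 2 * Mu) := by ring
    have h2 := sum_sum_mul_le_sqrt_mul_sqrt (box z (r + 2)) (fun y μ => ‖w (y + unitVec μ)‖) (fun _ _ => δ ^ 2 * Mu)
    rw [sqrt_sum_const_eq z hr (by positivity : 0 ≤ δ ^ 2 * Mu)] at h2
    exact h1.trans h2
  have e : ∑ y ∈ box z (r + 2), ∑ μ, (-⟪R y μ (w (y + unitVec μ)) - w y, R y μ (u (y + unitVec μ)) - u (y + unitVec μ)⟫_ℝ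
        - ⟪R y μ (w (y + unitVec μ)) - w (y + unitVec μ), R y μ (u (y + unitVec μ)) - u y⟫_ℝ
        + ⟪R y μ (w (y + unitVec μ)) - w (y + unitVec μ), R y μ (u (y + unitVec μ)) - u (y + unitVec μ)⟫_ℝ)
      = (∑ y ∈ box z (r + 2), ∑ μ, -⟪R y μ (w (y + unitVec μ)) - w y, R y μ (u (y + unitVec μ)) - u (y + unitVec μ)⟫_ℝ)
        + (∑ y ∈ box z (r + 2), ∑ μ, -⟪R y μ (w (y + unitVec μ)) - w (y + unitVec μ), R y μ (u (y + unitVec μ)) - u y⟫_ℝ)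
        + ∑ y ∈ box z (r + 2), ∑ μ, ⟪R y μ (w (y + unitVec μ)) - w (y + unitVec μ), R y μ (u (y + unitVec μ)) - u (y + unitVec μ)⟫_ℝ := by
    rw [← Finset.sum_add_distrib, ← Finset.sum_add_distrib]
    refine Finset.sum_congr rfl fun y _ => ?_
    rw [← Finset.sum_add_distrib, ← Finset.sum_add_distrib]
    exact Finset.sum_congr rfl fun μ _ => by ring
  rw [e]
  exact add_le_add (add_le_add T1 T2) T3

end Summit.QuantumFields.YangMills.Theorems.Prop7CovariantComparisonPairings

end
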